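import Literature.AlgebraicGeometry.HodgeTheory.SymmetricA3NonCommutationOfLocalisation
import Literature.AlgebraicGeometry.HodgeTheory.PicardLefschetzSymmetricA3Solo
import Literature.AlgebraicGeometry.HodgeTheory.PicardLefschetzSymmetricA3Junction
import Literature.AlgebraicGeometry.Motives.UniversalHypersurfaceBaseChart
import HarnessLib

/-!
# hN at the consumed site from ONE cohomological residual: «no transport around the symmetric `A₃` point is unipotent»

Family `hodge`, layer `Literature/AlgebraicGeometry/HodgeTheory`; proof file (theorems only, no definition, no named fact).  Written by the
prover seat `hodge-nonav-19716-p2` (g10, cell `hodge-nonav`) for crux K1-B `VeryGeneralSignCommutatorsInHg` (stmt-HodgeConjecture-19716,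
registry v25 = {hCDK, hN}) as the JUNCTION between prover-Bx's programme A₃-TRACE and the K1-B telescope.

Prover-Bx's glue `symmetricA3NonCommutation_of_circleTransport_not_unipotent` (p686818) derives the non-commutation clause
`SymmetricA3NonCommutation n d f₁ g₀ g₂ ψ εa` (odd `n`) from (i) one- and two-nodal Picard–Lefschetz data on the two circles of the
`B₂` unfolding, (ii) the bifurcation clauses at a common radius with `3/2·|ψ a′| ≤ R < εb`, and (iii) a loop `C` of forms
`f₁ + R e^{2πiθ} g₀` along which no rational transport is unipotent.  Here (i) is DISCHARGED by the unconditional pair data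
`symmetricA3PicardLefschetzPair₂_solo` (p685690: prover-Bx's one-node theorem p680592 and seat 20241-p1's exchanged-pair theorem p684662,
`g₀` a monomial), (ii) is read off `IsSymmetricA3Bifurcation` after shrinking `εa` (`ψ` is differentiable at `0` with `ψ 0 = 0`, so
`3/2·|ψ a′| ≤ R` near `0`), and the loop `C` is produced by `exists_point_path_pointForm_pencil`; what remains is (iii) for SOME radius
below any given bound — the statement H-A3NU below, the cohomological shadow of the localisation package H-A3LOC of the `A₃` port
(prover-Bx's `not_isNilpotent_sub_one_of_localisedRotation_fiberOver` turns H-A3LOC into H-A3NU).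

* `symmetricA3NonCommutation_mono_of_circleTransport_not_unipotent` — for a symmetric `A₃` datum with odd `n` and monomial `g₀`, and ANY
  bifurcation datum `(εa, εb, ψ)`: H-A3NU(f₁, g₀) ⟹ `∃ εa' ∈ (0, εa], SymmetricA3NonCommutation n d f₁ g₀ g₂ ψ εa'` — literally the body of
  the K1-B binder hN (`stub_a3NonComm`) at the consumed instance (odd `n`, `g₀ = c·xᵢ^d`).

H-A3NU(f₁, g₀) := for every `R₀ > 0` there is a radius `0 < R < R₀` and a loop `C` of forms `f₁ + R e^{2πiθ} g₀` in `U(ℂ)` along which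
no rational transport in degree `n` is unipotent (`¬ IsNilpotent (T − 1)`).  CONDITIONAL plumbing; nothing here proves HC; rung F-H1 not moved.

References: [ArnoldGuseinzadeVarchenko2012] AGZV, *Singularities of Differentiable Maps II*, Part I §2.3, §5.2; [VoisinHodgeII2003] Voisin,
*Hodge Theory and Complex Algebraic Geometry II*, §2.3.1, §3.2.1 Thm. 3.16.
-/

noncomputable section

open CategoryTheory AlgebraicGeometry MvPolynomial Filter Topology
open Literature.AlgebraicTopology.SingularHomology
open Literature.AlgebraicGeometry.Motives Literature.AlgebraicGeometry.Motives.UniversalHypersurface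

namespace Literature.AlgebraicGeometry.HodgeTheory

section HodgeTheory

variable {n d : ℕ} {f₁ g₀ g₂ : MvPolynomial (Fin (n + 2)) ℂ} {j k : Fin (n + 2)} {a : Fin (n + 2) → ℂˣ}
  {εa εb : ℝ} {ψ : ℂ → ℂ}

/-- **hN at the consumed instance from H-A3NU** (odd `n`, `g₀` a monomial `c·xᵢ^d`): if below every radius bound there is a loop of forms
`f₁ + R e^{2πiθ} g₀` along which no rational transport in degree `n` is unipotent, then for every bifurcation datum `(εa, εb, ψ)` of the
symmetric `A₃` datum there is `0 < εa' ≤ εa` with `SymmetricA3NonCommutation n d f₁ g₀ g₂ ψ εa'` — prover-Bx's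
`symmetricA3NonCommutation_of_circleTransport_not_unipotent` with the Picard–Lefschetz input discharged by `symmetricA3PicardLefschetzPair₂_solo`,
the bifurcation clauses shrunk to a common radius, and the loop from `exists_point_path_pointForm_pencil`.
[cite: ArnoldGuseinzadeVarchenko2012, Part I §5.2 and §2.3] [cite: VoisinHodgeII2003, §3.2.1 Thm. 3.16 and §2.3.1] -/
theorem symmetricA3NonCommutation_mono_of_circleTransport_not_unipotent (hn : 1 ≤ n) (hd : 1 ≤ d) (hodd : Odd n)
    (hg₀X : ∃ (i : Fin (n + 2)) (c : ℂ), g₀ = c • X i ^ d) (hf₁ : f₁.IsHomogeneous d) (hg₀ : g₀.IsHomogeneous d)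
    (hg₂ : g₂.IsHomogeneous d) (hD : IsSymmetricA3Datum f₁ g₀ g₂ j k a) (hB : IsSymmetricA3Bifurcation f₁ g₀ g₂ j a εa εb ψ)
    (hNU : ∀ R₀ : ℝ, 0 < R₀ → ∃ (R : ℝ) (s₀ : ComplexPoints (base ℂ n d)) (C : Path s₀ s₀), 0 < R ∧ R < R₀ ∧
      (∀ θ : unitInterval, pointForm ℂ n d (C θ) =
        f₁ + ((R : ℂ) * Complex.exp (2 * Real.pi * Complex.I * ((θ : ℝ) : ℂ))) • g₀) ∧
      ∀ (hU : IsCohomologicallyLocallyTrivialOn (family ℂ n d) Set.univ)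
        (T : bettiCohomology (fiberOver (family ℂ n d) s₀) n ≃ₗ[ℚ] bettiCohomology (fiberOver (family ℂ n d) s₀) n),
        IsRatTransport (family ℂ n d) n hU (loopClassUniv n d C) T → ¬ IsNilpotent (T.toLinearMap - 1)) :
    ∃ εa' : ℝ, 0 < εa' ∧ εa' ≤ εa ∧ SymmetricA3NonCommutation n d f₁ g₀ g₂ ψ εa' := by
  obtain ⟨hεa, hεb, hdiff, hψ0, hψne, -, hns, -⟩ := id hB
  -- (i) unconditional Picard–Lefschetz pair data below a radius `ε₁ ≤ εa`
  obtain ⟨ε₁, h₁, h₁le, hP₁⟩ := symmetricA3PicardLefschetzPair₂_solo hodd hg₀X hf₁ hg₀ hg₂ hD hB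
  -- (iii) the loop `C` of radius `R < εb` with no unipotent transport
  obtain ⟨R, s₀, C, hR0, hRb, hC, hNC⟩ := hNU εb hεb
  -- (ii) `3/2 |ψ a′| ≤ R` near `a′ = 0`: `ψ` is continuous at `0` with `ψ 0 = 0`
  have hcont : ContinuousAt ψ 0 :=
    (hdiff.continuousOn.continuousWithinAt (Metric.mem_ball_self hεa)).continuousAt (Metric.ball_mem_nhds 0 hεa)
  obtain ⟨η, hη, hηψ⟩ := Metric.continuousAt_iff.1 hcont (2 / 3 * R) (by positivity)
  refine ⟨min ε₁ η, lt_min h₁ hη, (min_le_left _ _).trans h₁le, ?_⟩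
  have hle : min ε₁ η ≤ εa := (min_le_left _ _).trans h₁le
  refine symmetricA3NonCommutation_of_circleTransport_not_unipotent hn hd hodd hf₁ hg₀ hg₂ hRb
    (fun a' ha ha0 => hψne a' (lt_of_lt_of_le ha hle) ha0) (fun a' ha => ?_)
    (fun a' b ha hb hb0 hbψ => (hns a' b (lt_of_lt_of_le ha hle) hb).2 ⟨hb0, hbψ⟩) C hC hNC
    (fun hU a' ha ha0 t₀ ht₀ γ₁ γ₂ hγ₁ hγ₂ => ?_)
  · -- `3/2 |ψ a′| ≤ R`
    have h := hηψ (lt_of_lt_of_le (by simpa using ha) (min_le_right _ _))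
    rw [hψ0, dist_zero_right] at h
    linarith
  · -- the pair data, repackaged
    obtain ⟨c₁, c₂, e₁, e₂, e₃, hPL₁, hPL₂⟩ :=
      hP₁ hn hd hU a' (lt_of_lt_of_le ha (min_le_left _ _)) ha0 t₀ ht₀ γ₁ γ₂ hγ₁ hγ₂
    exact ⟨⟨e₂, c₁, hPL₁⟩, ⟨e₁, e₃, c₂, hPL₂⟩⟩

/-- **The same with H-A3NU in its «all small radii» form** (the shape an analytic port at the `A₃` point delivers: some `R₀ > 0` such that for
EVERY `0 < R < R₀` and every loop of forms `f₁ + R e^{2πiθ} g₀` no rational transport is unipotent); the loop at a radius `R < min(R₀, εb)` exists by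
`exists_point_path_pointForm_pencil` since the members `f₁ + b g₀`, `0 < |b| < εb`, are nonsingular (bifurcation clause at `a′ = 0`).
[cite: ArnoldGuseinzadeVarchenko2012, Part I §5.2 and §2.3] [cite: VoisinHodgeII2003, §3.2.1 Thm. 3.16 and §2.3.1] -/
theorem symmetricA3NonCommutation_mono_of_forall_circleTransport_not_unipotent (hn : 1 ≤ n) (hd : 1 ≤ d) (hodd : Odd n)
    (hg₀X : ∃ (i : Fin (n + 2)) (c : ℂ), g₀ = c • X i ^ d) (hf₁ : f₁.IsHomogeneous d) (hg₀ : g₀.IsHomogeneous d)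
    (hg₂ : g₂.IsHomogeneous d) (hD : IsSymmetricA3Datum f₁ g₀ g₂ j k a) (hB : IsSymmetricA3Bifurcation f₁ g₀ g₂ j a εa εb ψ)
    (hNU : ∃ R₀ : ℝ, 0 < R₀ ∧ ∀ (R : ℝ), 0 < R → R < R₀ →
      ∀ (s₀ : ComplexPoints (base ℂ n d)) (C : Path s₀ s₀),
        (∀ θ : unitInterval, pointForm ℂ n d (C θ) =
          f₁ + ((R : ℂ) * Complex.exp (2 * Real.pi * Complex.I * ((θ : ℝ) : ℂ))) • g₀) →
        ∀ (hU : IsCohomologicallyLocallyTrivialOn (family ℂ n d) Set.univ)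
          (T : bettiCohomology (fiberOver (family ℂ n d) s₀) n ≃ₗ[ℚ] bettiCohomology (fiberOver (family ℂ n d) s₀) n),
          IsRatTransport (family ℂ n d) n hU (loopClassUniv n d C) T → ¬ IsNilpotent (T.toLinearMap - 1)) :
    ∃ εa' : ℝ, 0 < εa' ∧ εa' ≤ εa ∧ SymmetricA3NonCommutation n d f₁ g₀ g₂ ψ εa' := by
  refine symmetricA3NonCommutation_mono_of_circleTransport_not_unipotent hn hd hodd hg₀X hf₁ hg₀ hg₂ hD hB fun R₁ hR₁ => ?_
  obtain ⟨hεa, hεb, -, hψ0, -, -, hns, -⟩ := id hB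
  obtain ⟨R₀, hR₀, hNU⟩ := hNU
  -- a radius below `R₀`, `R₁` and `εb`
  set R : ℝ := min (min R₀ R₁) εb / 2 with hRdef
  have hm : 0 < min (min R₀ R₁) εb := lt_min (lt_min hR₀ hR₁) hεb
  have hR0 : 0 < R := by rw [hRdef]; positivity
  have hRlt : R < min (min R₀ R₁) εb := by rw [hRdef]; linarith
  have hRR₀ : R < R₀ := lt_of_lt_of_le hRlt ((min_le_left _ _).trans (min_le_left _ _))
  have hRR₁ : R < R₁ := lt_of_lt_of_le hRlt ((min_le_left _ _).trans (min_le_right _ _))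
  have hRb : R < εb := lt_of_lt_of_le hRlt (min_le_right _ _)
  -- the members of the circle of radius `R` are nonsingular (bifurcation clause at `a′ = 0`)
  have hJ : ∀ c : ℂ, ‖c‖ = |R| → SmoothHypersurface.IsNonsingularForm ℂ (f₁ + c • g₀) := by
    intro c hc
    rw [abs_of_pos hR0] at hc
    have hc0 : c ≠ 0 := by
      intro h0; rw [h0, norm_zero] at hc; exact hR0.ne' hc.symm
    have h := (hns 0 c (by simpa using hεa) (by rw [hc]; exact hRb)).2 ⟨hc0, by rw [hψ0]; exact hc0⟩
    simpa using h
  obtain ⟨s₀, C, -, hC⟩ := exists_point_path_pointForm_pencil n d hf₁ hg₀ hJ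
  exact ⟨R, s₀, C, hR0, hRR₁, fun θ => by rw [hC θ, pencilParam_apply], hNU R hR0 hRR₀ s₀ C fun θ => by
    rw [hC θ, pencilParam_apply]⟩

end HodgeTheory

end Literature.AlgebraicGeometry.HodgeTheory

end
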